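import Mathlib
import HarnessLib
import Summits.Ventures.LatticeQCDFlow.Scoring.ReweightedEDFHoeffding

/-!
# A finite-sample uniform band for the REWEIGHTED (self-normalised) empirical distribution
# function of a flow card's printed statistic, under a weight CEILING `p/q ≤ M`:
# `P(∃ t, δ + 1/K ≤ |F(t) − F̂ₙ(t)|) ≤ e^{−n/(2M²)} + 2(K + 1)·e^{−nδ²/(8M²)}`

HONEST FRAMING: exact (Metropolis-corrected) sampling algorithms for lattice gauge theory;
figures of merit are autocorrelation/cost numbers at stated couplings and volumes; no
continuum-physics claim.

Venture `LatticeQCDFlow` (cell pub-lqcd), topic `Scoring`; FANOUT row 4 (`s0-u1-b`, rung S0-B).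
Sequel of `Scoring/ReweightedEDFHoeffding` (the three Hoeffding events) and
`Scoring/GlivenkoCantelliRate` (the one-function sandwich `abs_cdf_sub_lt_of_grid`).  One
independent proposal stream `yᵢ` with laws `q dμ`, `q > 0`; a normalised target `p ≥ 0`,
`∫ p dμ = 1`, with a weight CEILING `p/q ≤ M`; a measurable statistic `O` with target law
`ρ = (p dμ)∘O⁻¹`, `F = cdf ρ` (atoms allowed); weights printed with any normalisation
`w̃ = c·p/q`, `c > 0`; the printed reweighted empirical distribution function
`F̂ₙ(t) = Σ_{i<n} w̃ᵢ·1{O(yᵢ) ≤ t}/Σ_{i<n} w̃ᵢ`.  **`measureReal_exists_reweightedEDF_dev_ge_le`**: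
for `K ≥ 1`, `δ > 0`, `n ≥ 1`,
`P(∃ t, δ + 1/K ≤ |F(t) − F̂ₙ(t)|) ≤ e^{−n/(2M²)} + 2(K + 1)·e^{−nδ²/(8M²)}`.
On the complement of the bad events the total weight `D > n/2`, every grid deviation is
`< (nδ/2)/D < δ`, and the sandwich bounds every deviation; the supremum event is handled by
outer measure.  NEW WORK of the cell; no definition; nothing cited as a fact.

## Content

* `weightedDev_div_lt` — the arithmetic `N < nδ/2`, `D > n/2` ⇒ `N/D < δ`;
* `sum_mul_sub_div`, `sum_mul_sub_div'` — the centred weighted sums over the total weight;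
* **`measureReal_exists_reweightedEDF_dev_ge_le`** — the band (grid form);
* `measureReal_exists_reweightedEDF_dev_ge_le_of_pos` — the `ε` form.

NOT CLAIMED: the ceiling-free regime; optimised constants; dependent proposals.
-/

noncomputable section

namespace Summit.Ventures.LatticeQCDFlow.Scoring.GlivenkoCantelli

open MeasureTheory ProbabilityTheory Finset Filter Function
open scoped Topology

/-! ## §1 Arithmetic -/

section Arithmetic

/-- `N < nδ/2` and `n/2 < D`, `δ > 0`, `n ≥ 1` ⇒ `N/D < δ`. [ours] -/
theorem weightedDev_div_lt {N D δ : ℝ} {n : ℕ} (hδ : 0 < δ) (hN : N < n * δ / 2)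
    (hD : (n : ℝ) / 2 < D) (hn : 1 ≤ n) : N / D < δ := by
  have hn0 : (0 : ℝ) < n := by exact_mod_cast hn
  have hD0 : 0 < D := lt_trans (by positivity) hD
  rw [div_lt_iff₀ hD0]
  nlinarith

/-- `Σ wᵢ(F − gᵢ) / Σ wᵢ = F − Σ wᵢgᵢ / Σ wᵢ` when `Σ wᵢ ≠ 0`. [ours] -/
theorem sum_mul_sub_div {n : ℕ} (w g : ℕ → ℝ) (F : ℝ) (hD : ∑ i ∈ range n, w i ≠ 0) :
    (∑ i ∈ range n, w i * (F - g i)) / (∑ i ∈ range n, w i)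
      = F - (∑ i ∈ range n, w i * g i) / (∑ i ∈ range n, w i) := by
  have e : ∑ i ∈ range n, w i * (F - g i) = F * ∑ i ∈ range n, w i - ∑ i ∈ range n, w i * g i := by
    simp only [mul_sub, Finset.sum_sub_distrib]
    rw [Finset.mul_sum]
    refine congrArg₂ _ (Finset.sum_congr rfl fun i _ => mul_comm _ _) rfl
  rw [e, sub_div, mul_div_assoc, div_self hD, mul_one]

/-- `Σ wᵢ(gᵢ − L) / Σ wᵢ = Σ wᵢgᵢ / Σ wᵢ − L` when `Σ wᵢ ≠ 0`. [ours] -/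
theorem sum_mul_sub_div' {n : ℕ} (w g : ℕ → ℝ) (L : ℝ) (hD : ∑ i ∈ range n, w i ≠ 0) :
    (∑ i ∈ range n, w i * (g i - L)) / (∑ i ∈ range n, w i)
      = (∑ i ∈ range n, w i * g i) / (∑ i ∈ range n, w i) - L := by
  have e : ∑ i ∈ range n, w i * (g i - L) = ∑ i ∈ range n, w i * g i - L * ∑ i ∈ range n, w i := by
    simp only [mul_sub, Finset.sum_sub_distrib]
    rw [Finset.mul_sum]
    refine congrArg₂ _ rfl (Finset.sum_congr rfl fun i _ => mul_comm _ _)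
  rw [e, sub_div, mul_div_assoc, div_self hD, mul_one]

end Arithmetic

/-! ## §2 The band -/

section Band

variable {Ω : Type*} [MeasurableSpace Ω] {P : Measure Ω} [IsProbabilityMeasure P]
variable {X : Type*} [MeasurableSpace X] {μ : Measure X} {p q O : X → ℝ} {y : ℕ → Ω → X}

/-- **THE FINITE-SAMPLE BAND FOR THE REWEIGHTED EMPIRICAL DISTRIBUTION FUNCTION (weight
ceiling).**  One independent proposal stream `yᵢ` (laws `q dμ`, `q > 0` measurable); target
`p ≥ 0` measurable, integrable, `∫ p dμ = 1`, with `p/q ≤ M`, `M > 0`; `O` measurable, target law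
`ρ = (p dμ)∘O⁻¹`; printed weights `w̃ = c·p/q`, `c > 0`; `K ≥ 1`, `δ > 0`, `n ≥ 1`.  Then
`P(∃ t, δ + 1/K ≤ |cdf ρ t − Σ_{i<n} w̃ᵢ1{O(yᵢ) ≤ t}/Σ_{i<n} w̃ᵢ|)
≤ e^{−n/(2M²)} + 2(K + 1)·e^{−nδ²/(8M²)}`. [ours] -/
theorem measureReal_exists_reweightedEDF_dev_ge_le (hym : ∀ j, Measurable (y j))
    (hind : iIndepFun y P)
    (hlaw : ∀ j, Measure.map (y j) P = μ.withDensity fun z => ENNReal.ofReal (q z))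
    (hp0 : ∀ z, 0 ≤ p z) (hpm : Measurable p) (hpi : Integrable p μ) (hp1 : ∫ z, p z ∂μ = 1)
    (hq0 : ∀ z, 0 < q z) (hqm : Measurable q) (hOm : Measurable O) {M : ℝ} (hM0 : 0 < M)
    (hM : ∀ z, p z / q z ≤ M) {wt : X → ℝ} {c : ℝ} (hc : 0 < c)
    (hwt : ∀ z, wt z = c * (p z / q z)) {K : ℕ} (hK : 1 ≤ K) {δ : ℝ} (hδ : 0 < δ) {n : ℕ}
    (hn : 1 ≤ n) :
    P.real {ω | ∃ t : ℝ, δ + 1 / K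
        ≤ |cdf ((μ.withDensity fun z => ENNReal.ofReal (p z)).map O) t
          - (∑ i ∈ range n, wt (y i ω) * (Set.Iic t).indicator (1 : ℝ → ℝ) (O (y i ω)))
            / (∑ i ∈ range n, wt (y i ω))|}
      ≤ Real.exp (-(n / (2 * M ^ 2)))
        + 2 * ((K : ℝ) + 1) * Real.exp (-(n * δ ^ 2 / (8 * M ^ 2))) := by
  haveI hρ := isProbabilityMeasure_targetLaw (μ := μ) hp0 hpi hp1 hOm
  set ρ : Measure ℝ := (μ.withDensity fun z => ENNReal.ofReal (p z)).map O with hρdef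
  set qg : ℕ → ℝ := fun j => sInf {x | (j : ℝ) / K ≤ cdf ρ x} with hqg
  -- the bad events
  set D₀ : Set Ω := {ω | ∑ i ∈ range n, p (y i ω) / q (y i ω) ≤ n / 2} with hD₀
  set A : ℕ → Set Ω := fun j => {ω | (n : ℝ) * δ / 2 ≤ ∑ i ∈ range n, p (y i ω) / q (y i ω)
    * (cdf ρ (qg j) - (Set.Iic (qg j)).indicator (1 : ℝ → ℝ) (O (y i ω)))} with hA
  set B : ℕ → Set Ω := fun j => {ω | (n : ℝ) * δ / 2 ≤ ∑ i ∈ range n, p (y i ω) / q (y i ω)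
    * ((Set.Iio (qg j)).indicator (1 : ℝ → ℝ) (O (y i ω)) - Function.leftLim (cdf ρ) (qg j))}
    with hB
  have hsub : {ω | ∃ t : ℝ, δ + 1 / K ≤ |cdf ρ t
        - (∑ i ∈ range n, wt (y i ω) * (Set.Iic t).indicator (1 : ℝ → ℝ) (O (y i ω)))
          / (∑ i ∈ range n, wt (y i ω))|}
      ⊆ D₀ ∪ ⋃ j ∈ Finset.range (K + 1), (A j ∪ B j) := by
    rintro ω ⟨t, ht⟩
    have hsf := reweightedEDF_scale_free (y := y) hc.ne' hwt
      (fun z => (Set.Iic t).indicator (1 : ℝ → ℝ) (O z)) n ω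
    beta_reduce at hsf
    rw [hsf] at ht
    by_contra hgood
    simp only [Set.mem_union, not_or] at hgood
    obtain ⟨hD, hAB⟩ := hgood
    have hDlt : (n : ℝ) / 2 < ∑ i ∈ range n, p (y i ω) / q (y i ω) := by
      simp only [hD₀, Set.mem_setOf_eq, not_le] at hD
      exact hD
    have hn0 : (0 : ℝ) < n := by exact_mod_cast hn
    have hDpos : 0 < ∑ i ∈ range n, p (y i ω) / q (y i ω) := lt_trans (by positivity) hDlt
    have hw0 : ∀ i, 0 ≤ p (y i ω) / q (y i ω) := fun i => div_nonneg (hp0 _) (hq0 _).le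
    have hnot : ∀ j, j ≤ K → ω ∉ A j ∧ ω ∉ B j := by
      intro j hj
      have hjm : j ∈ Finset.range (K + 1) := Finset.mem_range.2 (by omega)
      exact ⟨fun h => hAB (Set.mem_iUnion₂.2 ⟨j, hjm, Set.mem_union_left _ h⟩),
        fun h => hAB (Set.mem_iUnion₂.2 ⟨j, hjm, Set.mem_union_right _ h⟩)⟩
    have hlt := abs_cdf_sub_lt_of_grid ρ
      (F₁ := fun s => (∑ i ∈ range n, p (y i ω) / q (y i ω)
        * (Set.Iic s).indicator (1 : ℝ → ℝ) (O (y i ω))) / (∑ i ∈ range n, p (y i ω) / q (y i ω)))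
      (G₁ := fun s => (∑ i ∈ range n, p (y i ω) / q (y i ω)
        * (Set.Iio s).indicator (1 : ℝ → ℝ) (O (y i ω))) / (∑ i ∈ range n, p (y i ω) / q (y i ω)))
      (fun u v huv => div_le_div_of_nonneg_right (sum_le_sum fun i _ =>
        mul_le_mul_of_nonneg_left (indicator_Iic_mono _ huv) (hw0 i)) hDpos.le)
      (fun s => div_nonneg (sum_nonneg fun i _ =>
        mul_nonneg (hw0 i) (indicator_one_nonneg _ _)) hDpos.le)
      (fun s => div_le_one_of_le₀ (sum_le_sum fun i _ =>
        mul_le_of_le_one_right (hw0 i) (indicator_one_le_one _ _)) hDpos.le)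
      (fun u v huv => div_le_div_of_nonneg_right (sum_le_sum fun i _ =>
        mul_le_mul_of_nonneg_left (indicator_Iic_le_Iio huv _) (hw0 i)) hDpos.le)
      hK hδ
      (fun j hj => by
        have h := (hnot j hj).1
        simp only [hA, Set.mem_setOf_eq, not_le] at h
        have hdev := weightedDev_div_lt hδ h hDlt hn
        rw [sum_mul_sub_div (fun i => p (y i ω) / q (y i ω))
          (fun i => (Set.Iic (qg j)).indicator (1 : ℝ → ℝ) (O (y i ω))) _ hDpos.ne'] at hdev
        linarith)
      (fun j hj => by
        have h := (hnot j hj).2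
        simp only [hB, Set.mem_setOf_eq, not_le] at h
        have hdev := weightedDev_div_lt hδ h hDlt hn
        rw [sum_mul_sub_div' (fun i => p (y i ω) / q (y i ω))
          (fun i => (Set.Iio (qg j)).indicator (1 : ℝ → ℝ) (O (y i ω))) _ hDpos.ne'] at hdev
        linarith)
      t
    exact absurd ht (not_le.2 hlt)
  -- the probabilities of the bad events
  have hD₀P : P.real D₀ ≤ Real.exp (-(n / (2 * M ^ 2))) :=
    measureReal_weightSum_le_half_le hym hind hlaw hp0 hpm hp1 hq0 hqm hM0 hM n
  have hAj : ∀ j, P.real (A j) ≤ Real.exp (-(n * δ ^ 2 / (8 * M ^ 2))) := fun j =>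
    measureReal_weightedLowerDev_ge_le hym hind hlaw hp0 hpm hpi hp1 hq0 hqm hOm hM0 hM (qg j)
      hδ.le n
  have hBj : ∀ j, P.real (B j) ≤ Real.exp (-(n * δ ^ 2 / (8 * M ^ 2))) := fun j =>
    measureReal_weightedUpperDev_ge_le hym hind hlaw hp0 hpm hpi hp1 hq0 hqm hOm hM0 hM (qg j)
      hδ.le n
  calc P.real {ω | ∃ t : ℝ, δ + 1 / K ≤ |cdf ρ t
          - (∑ i ∈ range n, wt (y i ω) * (Set.Iic t).indicator (1 : ℝ → ℝ) (O (y i ω)))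
            / (∑ i ∈ range n, wt (y i ω))|}
      ≤ P.real (D₀ ∪ ⋃ j ∈ Finset.range (K + 1), (A j ∪ B j)) :=
        measureReal_mono hsub (measure_ne_top P _)
    _ ≤ P.real D₀ + P.real (⋃ j ∈ Finset.range (K + 1), (A j ∪ B j)) := measureReal_union_le _ _
    _ ≤ P.real D₀ + ∑ j ∈ Finset.range (K + 1), P.real (A j ∪ B j) := by
        gcongr
        exact measureReal_biUnion_finset_le _ _
    _ ≤ Real.exp (-(n / (2 * M ^ 2))) + ∑ j ∈ Finset.range (K + 1),
          (Real.exp (-(n * δ ^ 2 / (8 * M ^ 2))) + Real.exp (-(n * δ ^ 2 / (8 * M ^ 2)))) :=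
        add_le_add hD₀P (sum_le_sum fun j _ =>
          (measureReal_union_le _ _).trans (add_le_add (hAj j) (hBj j)))
    _ = Real.exp (-(n / (2 * M ^ 2)))
          + 2 * ((K : ℝ) + 1) * Real.exp (-(n * δ ^ 2 / (8 * M ^ 2))) := by
        rw [Finset.sum_const, Finset.card_range, nsmul_eq_mul]
        push_cast
        ring

/-- **THE REWEIGHTED BAND, ε form.**  Same setting; `ε > 0`, `n ≥ 1`:
`P(∃ t, ε ≤ |cdf ρ t − F̂ₙ(t)|) ≤ e^{−n/(2M²)} + 2(⌈2/ε⌉ + 1)·e^{−nε²/(32M²)}`. [ours]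
(`δ = ε/2`, `K = ⌈2/ε⌉`) -/
theorem measureReal_exists_reweightedEDF_dev_ge_le_of_pos (hym : ∀ j, Measurable (y j))
    (hind : iIndepFun y P)
    (hlaw : ∀ j, Measure.map (y j) P = μ.withDensity fun z => ENNReal.ofReal (q z))
    (hp0 : ∀ z, 0 ≤ p z) (hpm : Measurable p) (hpi : Integrable p μ) (hp1 : ∫ z, p z ∂μ = 1)
    (hq0 : ∀ z, 0 < q z) (hqm : Measurable q) (hOm : Measurable O) {M : ℝ} (hM0 : 0 < M)
    (hM : ∀ z, p z / q z ≤ M) {wt : X → ℝ} {c : ℝ} (hc : 0 < c)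
    (hwt : ∀ z, wt z = c * (p z / q z)) {ε : ℝ} (hε : 0 < ε) {n : ℕ} (hn : 1 ≤ n) :
    P.real {ω | ∃ t : ℝ, ε
        ≤ |cdf ((μ.withDensity fun z => ENNReal.ofReal (p z)).map O) t
          - (∑ i ∈ range n, wt (y i ω) * (Set.Iic t).indicator (1 : ℝ → ℝ) (O (y i ω)))
            / (∑ i ∈ range n, wt (y i ω))|}
      ≤ Real.exp (-(n / (2 * M ^ 2)))
        + 2 * ((⌈2 / ε⌉₊ : ℝ) + 1) * Real.exp (-(n * ε ^ 2 / (32 * M ^ 2))) := by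
  set K : ℕ := ⌈2 / ε⌉₊ with hK
  have hKpos : 1 ≤ K :=
    Nat.one_le_iff_ne_zero.2 (Nat.pos_iff_ne_zero.1 (Nat.ceil_pos.2 (by positivity)))
  have hK0 : (0 : ℝ) < K := by exact_mod_cast hKpos
  have hKε : 1 / (K : ℝ) ≤ ε / 2 := by
    have hle : 2 / ε ≤ (K : ℝ) := Nat.le_ceil _
    rw [div_le_iff₀ hK0]
    rw [div_le_iff₀ hε] at hle
    linarith [mul_comm (K : ℝ) ε]
  have h := measureReal_exists_reweightedEDF_dev_ge_le hym hind hlaw hp0 hpm hpi hp1 hq0 hqm hOm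
    hM0 hM hc hwt hKpos (half_pos hε) hn
  have hsub : {ω | ∃ t : ℝ, ε
        ≤ |cdf ((μ.withDensity fun z => ENNReal.ofReal (p z)).map O) t
          - (∑ i ∈ range n, wt (y i ω) * (Set.Iic t).indicator (1 : ℝ → ℝ) (O (y i ω)))
            / (∑ i ∈ range n, wt (y i ω))|}
      ⊆ {ω | ∃ t : ℝ, ε / 2 + 1 / K
        ≤ |cdf ((μ.withDensity fun z => ENNReal.ofReal (p z)).map O) t
          - (∑ i ∈ range n, wt (y i ω) * (Set.Iic t).indicator (1 : ℝ → ℝ) (O (y i ω)))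
            / (∑ i ∈ range n, wt (y i ω))|} := by
    rintro ω ⟨t, ht⟩
    exact ⟨t, le_trans (by linarith) ht⟩
  refine (measureReal_mono hsub).trans (h.trans (le_of_eq ?_))
  have e : -((n : ℝ) * (ε / 2) ^ 2 / (8 * M ^ 2)) = -(n * ε ^ 2 / (32 * M ^ 2)) := by ring
  rw [e]

end Band

end Summit.Ventures.LatticeQCDFlow.Scoring.GlivenkoCantelli

end
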